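import Literature.NumberTheory.Rogawski1990.TamagawaSingularMembersFinTFLetter          -- ★ p844223: S1′-fin-TF `TamagawaSingularMembersFinTF{,Closed}` — the text this file re-denominates (its frame, (Q-fin), (C1)-fin, (NORM), κ-block VERBATIM)
import Literature.NumberTheory.Automorphic.UnitaryGroupOfLocalCentralizerMeasureKit       -- ★ (O10-s) `UnitaryGroup.exists_tower_ofLocal_eq_quotientMeasure_of_atPoint_eq`: the tower vocabulary (model transport, cut-out, restricted product)
import HarnessLib

/-!
# [Rogawski1990 §14.5 p. 238 l. 1, p. 239 l. 9; Kottwitz1988 Thm. 1, Prop. 2; §1.7 p. 6, p. 11] S1′-fin-TF-COVOL — the letter S1′-fin-TF with its (K7-s) conjunct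
# RE-DENOMINATED as print's bare covolume constancy «`m(Z_c(L⁺)∖Z_c(𝔸)) = m(Z_{c′}(L⁺)∖Z_{c′}(𝔸))`» for the SPELLED Tamagawa-type centraliser measures (defs «y»)

Topic `NumberTheory/Rogawski1990`; namespace `Literature.NumberTheory.Rogawski1990`.  STATEMENT FILE (definition lane): two closed `def … : Prop` (the residual AT A FRAME and
CLOSED over all frames), nothing else; no theorem, no instance, no notation, no `sorry`.  Cell `pub/hodgecm-mathlib`, crux H413 = stmt-HodgeConjecture-24833; ROAD F′
«S1finTF ⟸ COVOL» (LEAD F0P3a-plan (g10) WORD T9-40 (d3), 2026-09-01; owner F0P3a-p07 (g10), OWNER SPEC F′-1 (s1)–(s4); spec = CENSUS (T′) «(K7-s)-TF ⟸ A PURE COVOLUME IDENTITY»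
`F0/P3a/F0P3a-p07/g10/CENSUS-Tprime-K7sTF-pure-covolume.F0P3ap07g10.md` 05e80e04d9df0551, VERDICT YES at M+); typed by F0P3-p02 (g13).  HONEST LABEL: HC_CM is proved only modulo the
printed citations until rung 0 closes; nothing here proves anything — the fact is a HYPOTHESIS wherever it is used.

WHAT AND WHY.  ★ `TamagawaSingularMembersFinTF` (p844223; books row «S1′-fin-TF») asserts, at a frame, `∃ mGs, (Q-fin) ∧ (C1)-fin ∧ (NORM) ∧ (K7-s)-TF ∧ κ-block-TF`, where (K7-s)-TF reads
«for every Haar family `νZ` on the adelic centralisers with `ofLocal mGs TF c = dνA ∕ dνZ(c)` at the singular non-central classes, the covolumes `vol(Z_c(L⁺)∖Z_c(𝔸); νZ c)` agree on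
stably conjugate `c`, `c′`» — print's sentence [Rogawski1990 §14.5 p. 238 l. 1 «`J(𝒪_st, f′) = ε_st(γ₀)⁻¹ m(Z G_{γ₀}∖G_{γ₀}) Σ_{γ ∈ C′} Φ(γ, f′)`», p. 239 l. 9 «`m(Z G′_{γ^δ}∖G′_{γ^δ}) = m(Z_H∖H)`
for every `δ`», «a special case of [Kt₆], Proposition 2»] seen THROUGH the in-house indirection `ofLocal … = quotientMeasure … νZ … νA` and an arbitrary adelic Haar measure `νA`.
THIS def is the same letter with that one conjunct replaced by **(T′)**: the covolume constancy for the centraliser measures SPELLED — at a singular non-central class `c` with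
`γ_c = toAdelic (out c)`, the measure `tA c` on `Z_c(𝔸) = U(H′)(𝔸)_{γ_c}` IS the restricted-product tower of the local Weil partners `tGs v (γ_c)_v` of (Q-fin) (model transport
`ψ_v = localPiEquiv`, level boxes `Z ∩ U(H′)(𝒪_v)` of mass one off an exceptional set `S₀` off which `mGs` is normalised at `γ_c`) times the archimedean TOP-FORM centraliser measure
★ `UnitaryArchTopForm.centralizerTopFormHaar L H′ (γ_c)_∞` [§1.7 p. 6 «`dg = c|Ω|_v` … compatible measures»], carried along `e = adelicProdEquiv⁻¹` — the equations being the
conclusion conjuncts of ★ (O10-s) `UnitaryGroup.exists_tower_ofLocal_eq_quotientMeasure_of_atPoint_eq` VERBATIM with `t := fun v => tGs v (γ_c)_v` and `ti := centralizerTopFormHaar …`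
(its group-measure conjuncts `νrp`, `νf`, `νi`, `νA` and the `ofLocal` reading dropped: NO `ofLocal`, NO `νA`, NO `νZ`; the model identifications `ψ`, `e` bound as DATA WITH EQUATIONS
exactly as the ★ (O10-c4-b) consumer `UnitaryGroup.covol_ofLocal_eq_of_isRegular_of_ofConjClass_eq` binds them, so the σ-algebra binders stay on the `cmDatum` spellings; the
finite-adelic model carriers `localPi`, `finAdelic` receive their σ-algebras as instance binders of (T′)).  Because (T′) must READ the Weil partners, the `∃ tGs` of (Q-fin) is
RE-SCOPED to the top and their conjugation-coherence (COH-fin) is recorded next to (Q-fin) (owner ruling F′-2 (a2): (T′) reads `tGs v` at the rational point `(γ_c)_v`, not at a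
class representative): the letter becomes `∃ mGs tGs, (Q-fin)[tGs] ∧ (COH-fin)[tGs] ∧ (C1)-fin ∧ (NORM) ∧ (T′)[tGs] ∧ κ-block-TF`, every other token byte-identical to ★ p844223
(generator-sliced from the tree file).  ONE binder is ADDED to the frame (CENSUS (T′) §1 (a), hazard H-a): `hK : ∀ v, νG_v(U(H′)(𝒪_v)) = 1` — the level normalisation of the local Haar data, which the
S1′ frame does not carry (`νG_v` is only Haar) but MAIN-b's frame does (`IsProductHaar`, conjunct `hPH.2.2.2.1`); it is the FIRST explicit binder of the framed def, read right after the frame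
(a `Prop`-valued `def` cannot take it as an unreferenced parameter); the frame's `νA`-triple is dropped (unused).  The
junction (W9) `finTF_of_finTFCovol : (hK) → TamagawaSingularMembersFinTFCovol … → TamagawaSingularMembersFinTF … νA` is ★ (O10-s) + ★ `isHaarMeasure_eq_of_quotientMeasure_eq`
(injectivity of `t ↦ dν ∕ dt`) + ★ `exists_atPoint_eq_quotientMeasure_of_isQuotientOf_singular_local_rational` + ★ `exists_atPoint_archSingularTopFormFamily_eq` (CENSUS (T′) §1
(a)(b)(c)) — a separate kernel-lane file, NOT here.  HONEST LABEL (as ★ p844223's): true as typed in print for Tamagawa-compatible finite members and Weil partners (level-normalised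
at the quasi-split-type local classes, `|ω|`-ratio-rescaled class-uniformly at the others) — the witness of the `∃ mGs tGs`; a HYPOTHESIS wherever used.

* `TamagawaSingularMembersFinTFCovol L H′ Tinf νH νG νGi νqi νHi` — S1′-fin-TF-COVOL AT A FRAME (p844223's frame VERBATIM minus the unused `νA`-triple; body `∀ hK hanis …`).
* `TamagawaSingularMembersFinTFCovolClosed` — CLOSED over all frames (the registrable constant for the closer edition «S1finTF ⟸ COVOL»; `hK` is the applied constant's first binder).

## References
* [Rogawski1990] J. D. Rogawski, *Automorphic Representations of Unitary Groups in Three Variables*, Ann. of Math. Stud. 123 (1990): §14.5 Lemma 14.5.2 (b) and proof pp. 238–239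
  (p. 238 l. 1, p. 239 l. 9); §8.2 Prop. 8.2.1 (a), (b) pp. 117–118; §1.7 p. 6, p. 11; §4.3 pp. 43–44; §5.4 p. 72; Prop. 10.1.2 (b) p. 146.
* [Kottwitz1988] R. E. Kottwitz, *Tamagawa numbers*, Ann. of Math. (2) 127 (1988): Thm. 1, Prop. 2.
* [LanglandsShelstad1987] R. P. Langlands, D. Shelstad, *On the definition of transfer factors*, Math. Ann. 278 (1987): §1.3–§1.4, §3–§4.
* [Gelbart1975] S. Gelbart, *Automorphic forms on adele groups* (1975): p. 155 (10.19), Remark 9.23.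
-/

noncomputable section

open MeasureTheory Measure NumberField IsDedekindDomain
open Literature.MeasureTheory.Group Literature.MeasureTheory.RestrictedProduct
open Literature.Topology.RestrictedProduct Literature.Topology.Algebra.RestrictedProduct
open scoped Matrix MatrixGroups RestrictedProduct

namespace Literature.NumberTheory.Rogawski1990

open Literature.NumberTheory.Automorphic
open Literature.AlgebraicGeometry.ShimuraVarieties (unitaryGroup hermForm)

section Frame

variable (L : Type) [Field L] [NumberField L] [IsCMField L]

variable (H' : Matrix (Fin 3) (Fin 3) L) (Tinf : ArchTransferFactor L H')
    -- σ-algebras of the `G′` side (★ (O10-c5) block), of `H_v`, `G_∞`, `H_∞`, and the Haar data — EXACTLY ★ `SingularEllipticTransfer`'s binders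
    [∀ g : (UnitaryGroup.cmDatum L 3 H').Adelic, MeasurableSpace ((UnitaryGroup.cmDatum L 3 H').Adelic ⧸ Subgroup.centralizer ({g} : Set (UnitaryGroup.cmDatum L 3 H').Adelic))]
    [∀ g : (UnitaryGroup.cmDatum L 3 H').Adelic, BorelSpace ((UnitaryGroup.cmDatum L 3 H').Adelic ⧸ Subgroup.centralizer ({g} : Set (UnitaryGroup.cmDatum L 3 H').Adelic))]
    [∀ γ : UnitaryGroup.arch (↥(maximalRealSubfield L)) L (IsCMField.complexConj L) 3 H',
      MeasurableSpace (UnitaryGroup.arch (↥(maximalRealSubfield L)) L (IsCMField.complexConj L) 3 H' ⧸ Subgroup.centralizer ({γ} : Set (UnitaryGroup.arch (↥(maximalRealSubfield L)) L (IsCMField.complexConj L) 3 H')))]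
    [∀ γ : UnitaryGroup.arch (↥(maximalRealSubfield L)) L (IsCMField.complexConj L) 3 H',
      BorelSpace (UnitaryGroup.arch (↥(maximalRealSubfield L)) L (IsCMField.complexConj L) 3 H' ⧸ Subgroup.centralizer ({γ} : Set (UnitaryGroup.arch (↥(maximalRealSubfield L)) L (IsCMField.complexConj L) 3 H')))]
    [∀ (v : HeightOneSpectrum (𝓞 ↥(maximalRealSubfield L))) (γ : (UnitaryGroup.cmDatum L 3 H').Local v),
      MeasurableSpace ((UnitaryGroup.cmDatum L 3 H').Local v ⧸ Subgroup.centralizer ({γ} : Set ((UnitaryGroup.cmDatum L 3 H').Local v)))]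
    [∀ (v : HeightOneSpectrum (𝓞 ↥(maximalRealSubfield L))) (γ : (UnitaryGroup.cmDatum L 3 H').Local v),
      BorelSpace ((UnitaryGroup.cmDatum L 3 H').Local v ⧸ Subgroup.centralizer ({γ} : Set ((UnitaryGroup.cmDatum L 3 H').Local v)))]
    [∀ v : HeightOneSpectrum (𝓞 ↥(maximalRealSubfield L)), MeasurableSpace ((UnitaryGroup.cmDatum L 3 H').Local v)] [∀ v : HeightOneSpectrum (𝓞 ↥(maximalRealSubfield L)), BorelSpace ((UnitaryGroup.cmDatum L 3 H').Local v)]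
    [MeasurableSpace (UnitaryGroup.cmDatum L 3 H').Adelic] [BorelSpace (UnitaryGroup.cmDatum L 3 H').Adelic]
    [MeasurableSpace (UnitaryGroup.arch (↥(maximalRealSubfield L)) L (IsCMField.complexConj L) 3 H')] [BorelSpace (UnitaryGroup.arch (↥(maximalRealSubfield L)) L (IsCMField.complexConj L) 3 H')]
    [∀ γ : (UnitaryGroup.cmDatum L 3 H').Adelic, MeasurableSpace (↥(Subgroup.centralizer ({γ} : Set (UnitaryGroup.cmDatum L 3 H').Adelic)) ⧸
      ((UnitaryGroup.cmDatum L 3 H').quotientSubgroup ⊓ Subgroup.centralizer ({γ} : Set (UnitaryGroup.cmDatum L 3 H').Adelic)).subgroupOf (Subgroup.centralizer ({γ} : Set (UnitaryGroup.cmDatum L 3 H').Adelic)))]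
    [∀ γ : (UnitaryGroup.cmDatum L 3 H').Adelic, BorelSpace (↥(Subgroup.centralizer ({γ} : Set (UnitaryGroup.cmDatum L 3 H').Adelic)) ⧸
      ((UnitaryGroup.cmDatum L 3 H').quotientSubgroup ⊓ Subgroup.centralizer ({γ} : Set (UnitaryGroup.cmDatum L 3 H').Adelic)).subgroupOf (Subgroup.centralizer ({γ} : Set (UnitaryGroup.cmDatum L 3 H').Adelic)))]
    [hCcl : ∀ γ : (UnitaryGroup.cmDatum L 3 H').Adelic, IsClosed ((Subgroup.centralizer ({γ} : Set (UnitaryGroup.cmDatum L 3 H').Adelic) : Subgroup (UnitaryGroup.cmDatum L 3 H').Adelic) : Set (UnitaryGroup.cmDatum L 3 H').Adelic)]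
    [∀ γ : (UnitaryGroup.cmDatum L 3 H').Adelic, (count : Measure ↥(((UnitaryGroup.cmDatum L 3 H').quotientSubgroup ⊓ Subgroup.centralizer ({γ} : Set (UnitaryGroup.cmDatum L 3 H').Adelic)).subgroupOf
      (Subgroup.centralizer ({γ} : Set (UnitaryGroup.cmDatum L 3 H').Adelic)))).IsHaarMeasure]
    [∀ v : HeightOneSpectrum (𝓞 ↥(maximalRealSubfield L)), MeasurableSpace ((UnitaryGroup.cmDatum L 2 (Matrix.of fun i j : Fin 2 => if i.val + j.val + 1 = 2 then (1 : L) else 0)).Local v ×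
        (UnitaryGroup.cmDatum L 1 (Matrix.of fun i j : Fin 1 => if i.val + j.val + 1 = 1 then (1 : L) else 0)).Local v)]
    [∀ v : HeightOneSpectrum (𝓞 ↥(maximalRealSubfield L)), BorelSpace ((UnitaryGroup.cmDatum L 2 (Matrix.of fun i j : Fin 2 => if i.val + j.val + 1 = 2 then (1 : L) else 0)).Local v ×
        (UnitaryGroup.cmDatum L 1 (Matrix.of fun i j : Fin 1 => if i.val + j.val + 1 = 1 then (1 : L) else 0)).Local v)]
    [∀ (v : HeightOneSpectrum (𝓞 ↥(maximalRealSubfield L))) (a : ((UnitaryGroup.cmDatum L 2 (Matrix.of fun i j : Fin 2 => if i.val + j.val + 1 = 2 then (1 : L) else 0)).Local v ×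
        (UnitaryGroup.cmDatum L 1 (Matrix.of fun i j : Fin 1 => if i.val + j.val + 1 = 1 then (1 : L) else 0)).Local v)),
      MeasurableSpace (((UnitaryGroup.cmDatum L 2 (Matrix.of fun i j : Fin 2 => if i.val + j.val + 1 = 2 then (1 : L) else 0)).Local v ×
        (UnitaryGroup.cmDatum L 1 (Matrix.of fun i j : Fin 1 => if i.val + j.val + 1 = 1 then (1 : L) else 0)).Local v) ⧸ Subgroup.centralizer ({a} : Set ((UnitaryGroup.cmDatum L 2 (Matrix.of fun i j : Fin 2 => if i.val + j.val + 1 = 2 then (1 : L) else 0)).Local v ×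
        (UnitaryGroup.cmDatum L 1 (Matrix.of fun i j : Fin 1 => if i.val + j.val + 1 = 1 then (1 : L) else 0)).Local v)))]
    [∀ (v : HeightOneSpectrum (𝓞 ↥(maximalRealSubfield L))) (a : ((UnitaryGroup.cmDatum L 2 (Matrix.of fun i j : Fin 2 => if i.val + j.val + 1 = 2 then (1 : L) else 0)).Local v ×
        (UnitaryGroup.cmDatum L 1 (Matrix.of fun i j : Fin 1 => if i.val + j.val + 1 = 1 then (1 : L) else 0)).Local v)),
      BorelSpace (((UnitaryGroup.cmDatum L 2 (Matrix.of fun i j : Fin 2 => if i.val + j.val + 1 = 2 then (1 : L) else 0)).Local v ×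
        (UnitaryGroup.cmDatum L 1 (Matrix.of fun i j : Fin 1 => if i.val + j.val + 1 = 1 then (1 : L) else 0)).Local v) ⧸ Subgroup.centralizer ({a} : Set ((UnitaryGroup.cmDatum L 2 (Matrix.of fun i j : Fin 2 => if i.val + j.val + 1 = 2 then (1 : L) else 0)).Local v ×
        (UnitaryGroup.cmDatum L 1 (Matrix.of fun i j : Fin 1 => if i.val + j.val + 1 = 1 then (1 : L) else 0)).Local v)))]
    [MeasurableSpace (UnitaryGroup.arch (↥(maximalRealSubfield L)) L (IsCMField.complexConj L) 3 (Matrix.of fun i j : Fin 3 => if i.val + j.val + 1 = 3 then (1 : L) else 0))] [BorelSpace (UnitaryGroup.arch (↥(maximalRealSubfield L)) L (IsCMField.complexConj L) 3 (Matrix.of fun i j : Fin 3 => if i.val + j.val + 1 = 3 then (1 : L) else 0))]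
    [∀ γ : UnitaryGroup.arch (↥(maximalRealSubfield L)) L (IsCMField.complexConj L) 3 (Matrix.of fun i j : Fin 3 => if i.val + j.val + 1 = 3 then (1 : L) else 0),
      MeasurableSpace (UnitaryGroup.arch (↥(maximalRealSubfield L)) L (IsCMField.complexConj L) 3 (Matrix.of fun i j : Fin 3 => if i.val + j.val + 1 = 3 then (1 : L) else 0) ⧸ Subgroup.centralizer ({γ} : Set (UnitaryGroup.arch (↥(maximalRealSubfield L)) L (IsCMField.complexConj L) 3 (Matrix.of fun i j : Fin 3 => if i.val + j.val + 1 = 3 then (1 : L) else 0))))]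
    [∀ γ : UnitaryGroup.arch (↥(maximalRealSubfield L)) L (IsCMField.complexConj L) 3 (Matrix.of fun i j : Fin 3 => if i.val + j.val + 1 = 3 then (1 : L) else 0),
      BorelSpace (UnitaryGroup.arch (↥(maximalRealSubfield L)) L (IsCMField.complexConj L) 3 (Matrix.of fun i j : Fin 3 => if i.val + j.val + 1 = 3 then (1 : L) else 0) ⧸ Subgroup.centralizer ({γ} : Set (UnitaryGroup.arch (↥(maximalRealSubfield L)) L (IsCMField.complexConj L) 3 (Matrix.of fun i j : Fin 3 => if i.val + j.val + 1 = 3 then (1 : L) else 0))))]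
    [MeasurableSpace (UnitaryGroup.arch (↥(maximalRealSubfield L)) L (IsCMField.complexConj L) 2 (Matrix.of fun i j : Fin 2 => if i.val + j.val + 1 = 2 then (1 : L) else 0) ×
          UnitaryGroup.arch (↥(maximalRealSubfield L)) L (IsCMField.complexConj L) 1 (Matrix.of fun i j : Fin 1 => if i.val + j.val + 1 = 1 then (1 : L) else 0))]
    [BorelSpace (UnitaryGroup.arch (↥(maximalRealSubfield L)) L (IsCMField.complexConj L) 2 (Matrix.of fun i j : Fin 2 => if i.val + j.val + 1 = 2 then (1 : L) else 0) ×
          UnitaryGroup.arch (↥(maximalRealSubfield L)) L (IsCMField.complexConj L) 1 (Matrix.of fun i j : Fin 1 => if i.val + j.val + 1 = 1 then (1 : L) else 0))]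
    [∀ a : (UnitaryGroup.arch (↥(maximalRealSubfield L)) L (IsCMField.complexConj L) 2 (Matrix.of fun i j : Fin 2 => if i.val + j.val + 1 = 2 then (1 : L) else 0) ×
          UnitaryGroup.arch (↥(maximalRealSubfield L)) L (IsCMField.complexConj L) 1 (Matrix.of fun i j : Fin 1 => if i.val + j.val + 1 = 1 then (1 : L) else 0)),
      MeasurableSpace ((UnitaryGroup.arch (↥(maximalRealSubfield L)) L (IsCMField.complexConj L) 2 (Matrix.of fun i j : Fin 2 => if i.val + j.val + 1 = 2 then (1 : L) else 0) ×
          UnitaryGroup.arch (↥(maximalRealSubfield L)) L (IsCMField.complexConj L) 1 (Matrix.of fun i j : Fin 1 => if i.val + j.val + 1 = 1 then (1 : L) else 0)) ⧸ Subgroup.centralizer ({a} : Set (UnitaryGroup.arch (↥(maximalRealSubfield L)) L (IsCMField.complexConj L) 2 (Matrix.of fun i j : Fin 2 => if i.val + j.val + 1 = 2 then (1 : L) else 0) ×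
          UnitaryGroup.arch (↥(maximalRealSubfield L)) L (IsCMField.complexConj L) 1 (Matrix.of fun i j : Fin 1 => if i.val + j.val + 1 = 1 then (1 : L) else 0))))]
    [∀ a : (UnitaryGroup.arch (↥(maximalRealSubfield L)) L (IsCMField.complexConj L) 2 (Matrix.of fun i j : Fin 2 => if i.val + j.val + 1 = 2 then (1 : L) else 0) ×
          UnitaryGroup.arch (↥(maximalRealSubfield L)) L (IsCMField.complexConj L) 1 (Matrix.of fun i j : Fin 1 => if i.val + j.val + 1 = 1 then (1 : L) else 0)),
      BorelSpace ((UnitaryGroup.arch (↥(maximalRealSubfield L)) L (IsCMField.complexConj L) 2 (Matrix.of fun i j : Fin 2 => if i.val + j.val + 1 = 2 then (1 : L) else 0) ×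
          UnitaryGroup.arch (↥(maximalRealSubfield L)) L (IsCMField.complexConj L) 1 (Matrix.of fun i j : Fin 1 => if i.val + j.val + 1 = 1 then (1 : L) else 0)) ⧸ Subgroup.centralizer ({a} : Set (UnitaryGroup.arch (↥(maximalRealSubfield L)) L (IsCMField.complexConj L) 2 (Matrix.of fun i j : Fin 2 => if i.val + j.val + 1 = 2 then (1 : L) else 0) ×
          UnitaryGroup.arch (↥(maximalRealSubfield L)) L (IsCMField.complexConj L) 1 (Matrix.of fun i j : Fin 1 => if i.val + j.val + 1 = 1 then (1 : L) else 0))))]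
    (νH : ∀ v : HeightOneSpectrum (𝓞 ↥(maximalRealSubfield L)), Measure ((UnitaryGroup.cmDatum L 2 (Matrix.of fun i j : Fin 2 => if i.val + j.val + 1 = 2 then (1 : L) else 0)).Local v ×
        (UnitaryGroup.cmDatum L 1 (Matrix.of fun i j : Fin 1 => if i.val + j.val + 1 = 1 then (1 : L) else 0)).Local v))
    (νG : ∀ v : HeightOneSpectrum (𝓞 ↥(maximalRealSubfield L)), Measure ((UnitaryGroup.cmDatum L 3 H').Local v))
    [∀ v, IsFiniteMeasureOnCompacts (νH v)] [∀ v, (νH v).IsMulRightInvariant]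
    [∀ v, (νG v).IsHaarMeasure] [∀ v, (νG v).IsMulRightInvariant]  -- MAIN-b's strength (F2): `νG_v` Haar
    (νGi : Measure (UnitaryGroup.arch (↥(maximalRealSubfield L)) L (IsCMField.complexConj L) 3 H')) (νqi : Measure (UnitaryGroup.arch (↥(maximalRealSubfield L)) L (IsCMField.complexConj L) 3 (Matrix.of fun i j : Fin 3 => if i.val + j.val + 1 = 3 then (1 : L) else 0)))
    (νHi : Measure (UnitaryGroup.arch (↥(maximalRealSubfield L)) L (IsCMField.complexConj L) 2 (Matrix.of fun i j : Fin 2 => if i.val + j.val + 1 = 2 then (1 : L) else 0) ×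
          UnitaryGroup.arch (↥(maximalRealSubfield L)) L (IsCMField.complexConj L) 1 (Matrix.of fun i j : Fin 1 => if i.val + j.val + 1 = 1 then (1 : L) else 0)))
    [IsFiniteMeasureOnCompacts νGi] [νGi.IsMulRightInvariant] [IsFiniteMeasureOnCompacts νqi] [νqi.IsMulRightInvariant]
    [IsFiniteMeasureOnCompacts νHi] [νHi.IsMulRightInvariant]

/-! ## §1 S1′-fin-TF-COVOL AT A FRAME -/

set_option maxHeartbeats 16000000 in
set_option synthInstance.maxHeartbeats 800000 in
-- HB: statement elaboration of the (T′) tower on the concrete `cmDatum` ∕ restricted-product carriers — the same budget as ★ (O10-s) `exists_tower_ofLocal_eq_quotientMeasure_of_atPoint_eq`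
/-- **[Rogawski1990 §14.5 L. 14.5.2 (b) pp. 238–239 (p. 238 l. 1, p. 239 l. 9); Kottwitz1988 Thm. 1, Prop. 2; §8.2 Prop. 8.2.1; §1.7 p. 6] S1′-fin-TF-COVOL AT A FRAME — FINITE SINGULAR
MEMBERS AND THEIR CONJUGATION-COHERENT LOCAL WEIL PARTNERS EXIST WITH (Q-fin) (COH-fin) (C1)-fin (NORM), THE TAMAGAWA-TYPE CENTRALISER MEASURES THEY SPELL HAVE EQUAL COVOLUMES ON THE
SINGULAR NON-CENTRAL STABLE CLASSES (T′), AND THE κ-LETTERS HOLD (κ-block-TF).**  Under the level normalisation `hK : νG_v(U(H′)(𝒪_v)) = 1` of the frame's local Haar data: `∃ mGs tGs` with (Q-fin) «`mGs v` is the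
Weil quotient `dνG_v ∕ d(tGs v x)` at the local classes meeting a non-regular rational point», (COH-fin) «`tGs v` is conjugation-coherent there» [§1.7 p. 6; §4.3 (4.3.1)], (C1)-fin «mass
one at the central points» [Prop. 10.1.2 (b)], (NORM) «normalised at every non-regular rational `γ₀` off a finite `S₀`» [§4.3 p. 44], **(T′)** «for every Haar family `tA` on the
`Z_c(𝔸)` that IS, at each singular non-central `c` and SOME `S₀` off which `mGs` is normalised at `γ_c`, the
restricted product of the model partners `(ψ_v⁻¹)_* tGs v (γ_c)_v` (mass one on the level boxes off `S₀`) cut out and carried to `Z((γ_c)_f)`, times ★ `centralizerTopFormHaar L H′ (γ_c)_∞`,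
carried along `e = adelicProdEquiv⁻¹` (★ O10-s's equations `ρ`, `ρM`, `tf`, `tP`, `tA` verbatim): `vol(Z_c(L⁺)∖Z_c(𝔸); tA c) = vol(Z_{c′}(L⁺)∖Z_{c′}(𝔸); tA c′)` whenever `c`, `c′` are
singular, non-central and stably conjugate» [p. 239 l. 9 «`m(Z G′_{γ^δ}∖G′_{γ^δ}) = m(Z_H∖H)`»; Kottwitz1988 Prop. 2: inner forms of one anisotropic group have equal Tamagawa numbers;
§1.7 p. 6, p. 11 «unnormalized Tamagawa measures»], and κ-block-TF = ★ p844223's VERBATIM [Prop. 8.2.1 (a), (b)].  HONEST LABEL: true as typed in print for Tamagawa-compatible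
finite members ∕ partners — the witness of the `∃`; a HYPOTHESIS wherever used; the junction to ★ `TamagawaSingularMembersFinTF` is a separate theorem (CENSUS (T′) §1).
[cite: Rogawski1990, §14.5 Lemma 14.5.2 (b) pp. 238–239; §8.2 Prop. 8.2.1 (a), (b) pp. 117–118; §1.7 p. 6, p. 11; §4.3 pp. 43–44; §5.4 p. 72; Prop. 10.1.2 (b) p. 146]
[cite: Kottwitz1988, Thm. 1, Prop. 2] [cite: LanglandsShelstad1987, §1.3–§1.4, §3–§4] [cite: Gelbart1975, p. 155 (10.19)] -/
def TamagawaSingularMembersFinTFCovol : Prop :=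
  ∀ (hK : ∀ v : HeightOneSpectrum (𝓞 ↥(maximalRealSubfield L)), νG v (UnitaryGroup.cmLocalIntegralLevel L 3 H' v : Set ((UnitaryGroup.cmDatum L 3 H').Local v)) = 1)
  (hanis : ∀ x : Fin 3 → L, hermForm (cmConjRingHom L) H' x x = 0 → x = 0)
  (Sbad : Finset (HeightOneSpectrum (𝓞 ↥(maximalRealSubfield L))))
      (Δ : ∀ v : HeightOneSpectrum (𝓞 ↥(maximalRealSubfield L)), LocalTransferFactor L H' v)
      (mH : ∀ v : HeightOneSpectrum (𝓞 ↥(maximalRealSubfield L)),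
        OrbitalMeasureFamily ((UnitaryGroup.cmDatum L 2 (Matrix.of fun i j : Fin 2 => if i.val + j.val + 1 = 2 then (1 : L) else 0)).Local v ×
          (UnitaryGroup.cmDatum L 1 (Matrix.of fun i j : Fin 1 => if i.val + j.val + 1 = 1 then (1 : L) else 0)).Local v))
      (mG : ∀ v : HeightOneSpectrum (𝓞 ↥(maximalRealSubfield L)), OrbitalMeasureFamily ((UnitaryGroup.cmDatum L 3 H').Local v))
  (m' : OrbitalMeasureFamily (UnitaryGroup.arch (↥(maximalRealSubfield L)) L (IsCMField.complexConj L) 3 H'))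
        (m : OrbitalMeasureFamily (UnitaryGroup.arch (↥(maximalRealSubfield L)) L (IsCMField.complexConj L) 3
          (Matrix.of fun i j : Fin 3 => if i.val + j.val + 1 = 3 then (1 : L) else 0)))
        (mHi : OrbitalMeasureFamily (UnitaryGroup.arch (↥(maximalRealSubfield L)) L (IsCMField.complexConj L) 2
            (Matrix.of fun i j : Fin 2 => if i.val + j.val + 1 = 2 then (1 : L) else 0) ×
          UnitaryGroup.arch (↥(maximalRealSubfield L)) L (IsCMField.complexConj L) 1
            (Matrix.of fun i j : Fin 1 => if i.val + j.val + 1 = 1 then (1 : L) else 0)))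
        (t' : ∀ γ' : UnitaryGroup.arch (↥(maximalRealSubfield L)) L (IsCMField.complexConj L) 3 H',
          Measure (Subgroup.centralizer ({γ'} : Set (UnitaryGroup.arch (↥(maximalRealSubfield L)) L (IsCMField.complexConj L) 3 H'))))
        (t : ∀ γ : UnitaryGroup.arch (↥(maximalRealSubfield L)) L (IsCMField.complexConj L) 3
            (Matrix.of fun i j : Fin 3 => if i.val + j.val + 1 = 3 then (1 : L) else 0),
          Measure (Subgroup.centralizer ({γ} : Set (UnitaryGroup.arch (↥(maximalRealSubfield L)) L (IsCMField.complexConj L) 3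
            (Matrix.of fun i j : Fin 3 => if i.val + j.val + 1 = 3 then (1 : L) else 0)))))
        (tH : ∀ γH : UnitaryGroup.arch (↥(maximalRealSubfield L)) L (IsCMField.complexConj L) 2
              (Matrix.of fun i j : Fin 2 => if i.val + j.val + 1 = 2 then (1 : L) else 0) ×
            UnitaryGroup.arch (↥(maximalRealSubfield L)) L (IsCMField.complexConj L) 1
              (Matrix.of fun i j : Fin 1 => if i.val + j.val + 1 = 1 then (1 : L) else 0),
          Measure (Subgroup.centralizer ({γH} : Set (UnitaryGroup.arch (↥(maximalRealSubfield L)) L (IsCMField.complexConj L) 2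
              (Matrix.of fun i j : Fin 2 => if i.val + j.val + 1 = 2 then (1 : L) else 0) ×
            UnitaryGroup.arch (↥(maximalRealSubfield L)) L (IsCMField.complexConj L) 1
              (Matrix.of fun i j : Fin 1 => if i.val + j.val + 1 = 1 then (1 : L) else 0)))))
    (hherm : (H'.map (cmConjRingHom L)).transpose = H')
    (hCTM : CanonicalTransferMatrix L H' Tinf.Δ νH νG Sbad Δ mH mG)
    (hACS : ArchCanonicalSingularMatrix L H' Tinf νGi νqi νHi hanis m' m mHi t' t tH),
    ∃ (mGs : ∀ v : HeightOneSpectrum (𝓞 ↥(maximalRealSubfield L)), OrbitalMeasureFamily ((UnitaryGroup.cmDatum L 3 H').Local v))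
      -- the local Weil partners `tGs` of (Q-fin), HOISTED next to `mGs` so that (T′) reads them (★ p844223 binds them inside (Q-fin))
      (tGs : ∀ (v : HeightOneSpectrum (𝓞 ↥(maximalRealSubfield L))) (γ : (UnitaryGroup.cmDatum L 3 H').Local v), Measure ↥(Subgroup.centralizer ({γ} : Set ((UnitaryGroup.cmDatum L 3 H').Local v)))),
      -- (Q-fin) VERBATIM but for the hoisted `tGs`: the local members are Weil quotients of `νG_v` by `tGs v` at the classes corresponding to non-regular rational points
      (∀ v, (mGs v).IsQuotientOf (fun x : (UnitaryGroup.cmDatum L 3 H').Local v => ∃ γ₀ : (UnitaryGroup.cmDatum L 3 H').Rational, ¬ IsRegularElt (γ₀.val : GL (Fin 3) L) ∧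
            Corresponds (UnitaryGroup.conjLocal L (IsCMField.complexConj L) v)
              ((UnitaryGroup.adelicForm L 3 H').map (UnitaryGroup.adeleToLocal L v))
              ((UnitaryGroup.adelicForm L 3 H').map (UnitaryGroup.adeleToLocal L v))
              ((UnitaryGroup.cmDatum L 3 H').toLocal v ((UnitaryGroup.cmDatum L 3 H').toAdelic γ₀)) x) (νG v) (tGs v)) ∧
      -- (COH-fin) [§1.7 p. 6; §4.3 (4.3.1) p. 43] the local Weil partners are CONJUGATION-COHERENT on (Q-fin)'s guard: transporting `tGs v γ₁` along `conj q : Z(γ₁) ≃ Z(q γ₁ q⁻¹)` gives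
      -- `tGs v (q γ₁ q⁻¹)` — token shape = the `hcoh` binder of ★ `OrbitalMeasureFamily.IsQuotientOf.atPoint_eq_quotientMeasure_of_forall_map_conj_eq` at `G := U(H′)(L⁺_v)`, `P :=` the guard,
      -- `t := tGs v` (so (T′)'s `tGs v (γ_c)_v`, read at the rational point and not at a class representative, is pinned: owner ruling F′-2 (a2); print's `|ω|_v`-partners have it)
      (∀ (v : HeightOneSpectrum (𝓞 ↥(maximalRealSubfield L))) (γ₁ γ₂ q : (UnitaryGroup.cmDatum L 3 H').Local v) (hq : (MulAut.conj q : (UnitaryGroup.cmDatum L 3 H').Local v ≃* (UnitaryGroup.cmDatum L 3 H').Local v) γ₁ = γ₂),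
        (∃ γ₀ : (UnitaryGroup.cmDatum L 3 H').Rational, ¬ IsRegularElt (γ₀.val : GL (Fin 3) L) ∧
            Corresponds (UnitaryGroup.conjLocal L (IsCMField.complexConj L) v)
              ((UnitaryGroup.adelicForm L 3 H').map (UnitaryGroup.adeleToLocal L v))
              ((UnitaryGroup.adelicForm L 3 H').map (UnitaryGroup.adeleToLocal L v))
              ((UnitaryGroup.cmDatum L 3 H').toLocal v ((UnitaryGroup.cmDatum L 3 H').toAdelic γ₀)) γ₁) →
        Measure.map (subgroupCongrHomeomorph (MulAut.conj q : (UnitaryGroup.cmDatum L 3 H').Local v ≃* (UnitaryGroup.cmDatum L 3 H').Local v) (Subgroup.centralizer ({γ₁} : Set ((UnitaryGroup.cmDatum L 3 H').Local v)))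
          (Subgroup.centralizer ({γ₂} : Set ((UnitaryGroup.cmDatum L 3 H').Local v))) (forall_apply_mem_centralizer_singleton_iff_of_eq (MulAut.conj q : (UnitaryGroup.cmDatum L 3 H').Local v ≃* (UnitaryGroup.cmDatum L 3 H').Local v) hq)
          (continuous_mulAutConj q) (continuous_mulAutConj_symm q)) (tGs v γ₁) = tGs v γ₂) ∧
      -- (C1)-fin mass one of the FINITE members at the central points [Prop. 10.1.2 (b): `Φ(ζ, f) = f(ζ)`]
      (∀ c : ConjClasses (UnitaryGroup.cmDatum L 3 H').Rational,
        (∃ ζ : L, (((Quotient.out c).val : GL (Fin 3) L) : Matrix (Fin 3) (Fin 3) L) = ζ • (1 : Matrix (Fin 3) (Fin 3) L)) →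
        ∀ v, (mGs v).atPoint ((UnitaryGroup.cmDatum L 3 H').toLocal v ((UnitaryGroup.cmDatum L 3 H').toAdelic (Quotient.out c))) Set.univ = 1) ∧
      -- (NORM) VERBATIM
      (∀ γ₀ : (UnitaryGroup.cmDatum L 3 H').Rational, ¬ IsRegularElt (γ₀.val : GL (Fin 3) L) →
        ∃ S₀ : Finset (HeightOneSpectrum (𝓞 ↥(maximalRealSubfield L))), UnitaryGroup.IsNormalisedOff L 3 H' mGs ((UnitaryGroup.cmDatum L 3 H').toAdelic γ₀) S₀) ∧
      -- (T′) [Rogawski1990 §14.5 p. 238 l. 1, p. 239 l. 9; Kottwitz1988 Thm. 1 ∕ Prop. 2; §1.7 p. 6, p. 11] PRINT'S COVOLUME CONSTANCY ON THE SINGULAR NON-CENTRAL STABLE CLASSES, THE MEASURES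
      -- SPELLED AS ANTECEDENT EQUATIONS (no `ofLocal`, no `νA`, no `νZ`): for every family `tA c` of Haar measures on the adelic centralisers `Z_c(𝔸)` which, at each singular
      -- non-central `c`, for SOME exceptional set `S₀` off which `mGs` is normalised at `γ_c`, IS the restricted-product tower of the local Weil partners `tGs v (γ_c)_v`
      -- (model transport `ψ_v = localPiEquiv`, level boxes `Z ∩ K_v` of mass one off `S₀`) times the archimedean TOP-FORM centraliser measure ★ `centralizerTopFormHaar L H′ (γ_c)_∞`
      -- along `e = adelicProdEquiv⁻¹` — the equations are ★ (O10-s) `UnitaryGroup.exists_tower_ofLocal_eq_quotientMeasure_of_atPoint_eq`'s conclusion conjuncts VERBATIM with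
      -- `t := fun v => tGs v (γ_c)_v`, `ti := centralizerTopFormHaar L H′ (γ_c)_∞`, the model identifications bound as DATA WITH EQUATIONS as ★ (O10-c4-b)'s consumer binds them —
      -- the covolumes `vol(Z_c(L⁺)∖Z_c(𝔸); tA c)` agree on stably conjugate singular non-central `c`, `c′` (covolume tokens = ★ p844223's (K7-s) conclusion with `νZ ↦ tA`)
      (∀ [∀ v : HeightOneSpectrum (𝓞 ↥(maximalRealSubfield L)), MeasurableSpace ↥(UnitaryGroup.localPi L (IsCMField.complexConj L) 3 H' v)]
          [∀ v : HeightOneSpectrum (𝓞 ↥(maximalRealSubfield L)), BorelSpace ↥(UnitaryGroup.localPi L (IsCMField.complexConj L) 3 H' v)]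
          [MeasurableSpace ↥(UnitaryGroup.finAdelic (↥(maximalRealSubfield L)) L (IsCMField.complexConj L) 3 H')] [BorelSpace ↥(UnitaryGroup.finAdelic (↥(maximalRealSubfield L)) L (IsCMField.complexConj L) 3 H')]
          (ψ : ∀ v : HeightOneSpectrum (𝓞 ↥(maximalRealSubfield L)), ↥(UnitaryGroup.localPi L (IsCMField.complexConj L) 3 H' v) ≃ₜ* (UnitaryGroup.cmDatum L 3 H').Local v)
          (hψ : ψ = fun v => UnitaryGroup.localPiEquiv L (IsCMField.complexConj L) 3 H' v)
          (e : ↥(UnitaryGroup.arch (↥(maximalRealSubfield L)) L (IsCMField.complexConj L) 3 H') × ↥(UnitaryGroup.finAdelic (↥(maximalRealSubfield L)) L (IsCMField.complexConj L) 3 H') ≃* (UnitaryGroup.cmDatum L 3 H').Adelic)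
          (_ : e = (UnitaryGroup.adelicProdEquiv (↥(maximalRealSubfield L)) L (IsCMField.complexConj L) 3 H').symm.toMulEquiv) (he : Continuous e) (hes : Continuous e.symm)
          (hg : ∀ g : (UnitaryGroup.cmDatum L 3 H').Adelic, e (UnitaryGroup.archPart (↥(maximalRealSubfield L)) L (IsCMField.complexConj L) 3 H' g, UnitaryGroup.finPart (↥(maximalRealSubfield L)) L (IsCMField.complexConj L) 3 H' g) = g)
          (tA : ∀ c : ConjClasses (UnitaryGroup.cmDatum L 3 H').Rational, Measure (Subgroup.centralizer ({((UnitaryGroup.cmDatum L 3 H').toAdelic (Quotient.out c))} : Set (UnitaryGroup.cmDatum L 3 H').Adelic)))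
          (_ : ∀ c, IsHaarMeasure (tA c)) (_ : ∀ c, (tA c).IsMulRightInvariant) (_ : ∀ c, (tA c).IsInvInvariant),
        (∀ c : ConjClasses (UnitaryGroup.cmDatum L 3 H').Rational, ¬ IsRegularElt ((Quotient.out c).val : GL (Fin 3) L) →
          (¬ ∃ ζ : L, (((Quotient.out c).val : GL (Fin 3) L) : Matrix (Fin 3) (Fin 3) L) = ζ • (1 : Matrix (Fin 3) (Fin 3) L)) →
          ∃ S₀ : Finset (HeightOneSpectrum (𝓞 ↥(maximalRealSubfield L))), UnitaryGroup.IsNormalisedOff L 3 H' mGs ((UnitaryGroup.cmDatum L 3 H').toAdelic (Quotient.out c)) S₀ ∧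
          ∃ (ρ : Measure (cutout (fun v => UnitaryGroup.localInt L (IsCMField.complexConj L) 3 H' v) (fun v => (Subgroup.centralizer ({(UnitaryGroup.finAdelicEquiv (↥(maximalRealSubfield L)) L (IsCMField.complexConj L) 3 H') (UnitaryGroup.finPart (↥(maximalRealSubfield L)) L (IsCMField.complexConj L) 3 H' ((UnitaryGroup.cmDatum L 3 H').toAdelic (Quotient.out c))) v} : Set ↥(UnitaryGroup.localPi L (IsCMField.complexConj L) 3 H' v)))))) (ρM : Measure (Subgroup.centralizer ({(UnitaryGroup.finAdelicEquiv (↥(maximalRealSubfield L)) L (IsCMField.complexConj L) 3 H') (UnitaryGroup.finPart (↥(maximalRealSubfield L)) L (IsCMField.complexConj L) 3 H' ((UnitaryGroup.cmDatum L 3 H').toAdelic (Quotient.out c)))} : Set (Πʳ v : HeightOneSpectrum (𝓞 ↥(maximalRealSubfield L)), [↥(UnitaryGroup.localPi L (IsCMField.complexConj L) 3 H' v), UnitaryGroup.localInt L (IsCMField.complexConj L) 3 H' v])))) (tf : Measure (Subgroup.centralizer ({(UnitaryGroup.finPart (↥(maximalRealSubfield L)) L (IsCMField.complexConj L) 3 H'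 ((UnitaryGroup.cmDatum L 3 H').toAdelic (Quotient.out c)))} : Set (UnitaryGroup.finAdelic (↥(maximalRealSubfield L)) L (IsCMField.complexConj L) 3 H'))))
            (tP : Measure ((Subgroup.centralizer ({UnitaryGroup.archPart (↥(maximalRealSubfield L)) L (IsCMField.complexConj L) 3 H' ((UnitaryGroup.cmDatum L 3 H').toAdelic (Quotient.out c))} : Set (UnitaryGroup.arch (↥(maximalRealSubfield L)) L (IsCMField.complexConj L) 3 H'))).prod (Subgroup.centralizer ({(UnitaryGroup.finPart (↥(maximalRealSubfield L)) L (IsCMField.complexConj L) 3 H' ((UnitaryGroup.cmDatum L 3 H').toAdelic (Quotient.out c)))} : Set (UnitaryGroup.finAdelic (↥(maximalRealSubfield L)) L (IsCMField.complexConj L) 3 H'))))),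
            -- the model local Weil partners give mass one to the level boxes off `S₀` (★ O10-s conjunct «ht1»)
            (∀ v, v ∉ S₀ → (Measure.map (subgroupCongrHomeomorph (ψ v).symm.toMulEquiv (Subgroup.centralizer ({((UnitaryGroup.cmDatum L 3 H').toLocal v ((UnitaryGroup.cmDatum L 3 H').toAdelic (Quotient.out c)))} : Set ((UnitaryGroup.cmDatum L 3 H').Local v))) (Subgroup.centralizer ({(UnitaryGroup.finAdelicEquiv (↥(maximalRealSubfield L)) L (IsCMField.complexConj L) 3 H') (UnitaryGroup.finPart (↥(maximalRealSubfield L)) L (IsCMField.complexConj L) 3 H' ((UnitaryGroup.cmDatum L 3 H').toAdelic (Quotient.out c))) v} : Set ↥(UnitaryGroup.localPi L (IsCMField.complexConj L) 3 H' v))) (UnitaryGroup.localPiEquiv_symm_mem_centralizer_iff L 3 H' v ((UnitaryGroup.cmDatum L 3 H').toAdelic (Quotient.out c)) (ψ v) (congrFun hψ v)) (ψ v).symm.continuous (ψ v).continuous) (tGs v ((UnitaryGroup.cmDatum L 3 H').toLocal v ((UnitaryGroup.cmDatum L 3 H').toAdelic (Quotient.out c))))) ((((inH (fun v => UnitaryGroup.localInt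 L (IsCMField.complexConj L) 3 H' v) (fun v => (Subgroup.centralizer ({(UnitaryGroup.finAdelicEquiv (↥(maximalRealSubfield L)) L (IsCMField.complexConj L) 3 H') (UnitaryGroup.finPart (↥(maximalRealSubfield L)) L (IsCMField.complexConj L) 3 H' ((UnitaryGroup.cmDatum L 3 H').toAdelic (Quotient.out c))) v} : Set ↥(UnitaryGroup.localPi L (IsCMField.complexConj L) 3 H' v)))) v) : Subgroup (Subgroup.centralizer ({(UnitaryGroup.finAdelicEquiv (↥(maximalRealSubfield L)) L (IsCMField.complexConj L) 3 H') (UnitaryGroup.finPart (↥(maximalRealSubfield L)) L (IsCMField.complexConj L) 3 H' ((UnitaryGroup.cmDatum L 3 H').toAdelic (Quotient.out c))) v} : Set ↥(UnitaryGroup.localPi L (IsCMField.complexConj L) 3 H' v)))) : Set (Subgroup.centralizer ({(UnitaryGroup.finAdelicEquiv (↥(maximalRealSubfield L)) L (IsCMField.complexConj L) 3 H') (UnitaryGroup.finPart (↥(maximalRealSubfield L)) L (IsCMField.complexConj L) 3 H' ((UnitaryGroup.cmDatum L 3 H').toAdelic (Quotient.out c))) v} : Set ↥(UnitaryGroup.localPi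 L (IsCMField.complexConj L) 3 H' v))))) = 1) ∧
            -- the finite-adelic centraliser measure: restricted product of the model local partners, cut out and carried to `Z(γ_f) ≤ U(H)(𝔸_f)` (★ O10-s `ρ`, `ρM`, `tf`)
            ρ = Measure.map (cutoutEquiv (fun v => UnitaryGroup.localInt L (IsCMField.complexConj L) 3 H' v) (fun v => (Subgroup.centralizer ({(UnitaryGroup.finAdelicEquiv (↥(maximalRealSubfield L)) L (IsCMField.complexConj L) 3 H') (UnitaryGroup.finPart (↥(maximalRealSubfield L)) L (IsCMField.complexConj L) 3 H' ((UnitaryGroup.cmDatum L 3 H').toAdelic (Quotient.out c))) v} : Set ↥(UnitaryGroup.localPi L (IsCMField.complexConj L) 3 H' v)))))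
            (rpMeasure (fun v => (((inH (fun v => UnitaryGroup.localInt L (IsCMField.complexConj L) 3 H' v) (fun v => (Subgroup.centralizer ({(UnitaryGroup.finAdelicEquiv (↥(maximalRealSubfield L)) L (IsCMField.complexConj L) 3 H') (UnitaryGroup.finPart (↥(maximalRealSubfield L)) L (IsCMField.complexConj L) 3 H' ((UnitaryGroup.cmDatum L 3 H').toAdelic (Quotient.out c))) v} : Set ↥(UnitaryGroup.localPi L (IsCMField.complexConj L) 3 H' v)))) v) : Subgroup (Subgroup.centralizer ({(UnitaryGroup.finAdelicEquiv (↥(maximalRealSubfield L)) L (IsCMField.complexConj L) 3 H') (UnitaryGroup.finPart (↥(maximalRealSubfield L)) L (IsCMField.complexConj L) 3 H' ((UnitaryGroup.cmDatum L 3 H').toAdelic (Quotient.out c))) v} : Set ↥(UnitaryGroup.localPi L (IsCMField.complexConj L) 3 H' v)))) : Set (Subgroup.centralizer ({(UnitaryGroup.finAdelicEquiv (↥(maximalRealSubfield L)) L (IsCMField.complexConj L) 3 H') (UnitaryGroup.finPart (↥(maximalRealSubfield L)) L (IsCMField.complexConj L) 3 H' ((UnitaryGroup.cmDatum L 3 H').toAdelic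 (Quotient.out c))) v} : Set ↥(UnitaryGroup.localPi L (IsCMField.complexConj L) 3 H' v))))) (fun v => (Measure.map (subgroupCongrHomeomorph (ψ v).symm.toMulEquiv (Subgroup.centralizer ({((UnitaryGroup.cmDatum L 3 H').toLocal v ((UnitaryGroup.cmDatum L 3 H').toAdelic (Quotient.out c)))} : Set ((UnitaryGroup.cmDatum L 3 H').Local v))) (Subgroup.centralizer ({(UnitaryGroup.finAdelicEquiv (↥(maximalRealSubfield L)) L (IsCMField.complexConj L) 3 H') (UnitaryGroup.finPart (↥(maximalRealSubfield L)) L (IsCMField.complexConj L) 3 H' ((UnitaryGroup.cmDatum L 3 H').toAdelic (Quotient.out c))) v} : Set ↥(UnitaryGroup.localPi L (IsCMField.complexConj L) 3 H' v))) (UnitaryGroup.localPiEquiv_symm_mem_centralizer_iff L 3 H' v ((UnitaryGroup.cmDatum L 3 H').toAdelic (Quotient.out c)) (ψ v) (congrFun hψ v)) (ψ v).symm.continuous (ψ v).continuous) (tGs v ((UnitaryGroup.cmDatum L 3 H').toLocal v ((UnitaryGroup.cmDatum L 3 H').toAdelic (Quotient.out c)))))) S₀) ∧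
            ρM = Measure.map (subgroupCongrHomeomorph (MulEquiv.refl (Πʳ v : HeightOneSpectrum (𝓞 ↥(maximalRealSubfield L)), [↥(UnitaryGroup.localPi L (IsCMField.complexConj L) 3 H' v), UnitaryGroup.localInt L (IsCMField.complexConj L) 3 H' v])) (cutout (fun v => UnitaryGroup.localInt L (IsCMField.complexConj L) 3 H' v) (fun v => (Subgroup.centralizer ({(UnitaryGroup.finAdelicEquiv (↥(maximalRealSubfield L)) L (IsCMField.complexConj L) 3 H') (UnitaryGroup.finPart (↥(maximalRealSubfield L)) L (IsCMField.complexConj L) 3 H' ((UnitaryGroup.cmDatum L 3 H').toAdelic (Quotient.out c))) v} : Set ↥(UnitaryGroup.localPi L (IsCMField.complexConj L) 3 H' v))))) (Subgroup.centralizer ({(UnitaryGroup.finAdelicEquiv (↥(maximalRealSubfield L)) L (IsCMField.complexConj L) 3 H') (UnitaryGroup.finPart (↥(maximalRealSubfield L)) L (IsCMField.complexConj L) 3 H' ((UnitaryGroup.cmDatum L 3 H').toAdelic (Quotient.out c)))} : Set (Πʳ v : HeightOneSpectrum (𝓞 ↥(maximalRealSubfield L)), [↥(UnitaryGroup.localPi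 L (IsCMField.complexConj L) 3 H' v), UnitaryGroup.localInt L (IsCMField.complexConj L) 3 H' v]))) (forall_refl_mem_iff (fun v => UnitaryGroup.localInt L (IsCMField.complexConj L) 3 H' v) (fun v => (Subgroup.centralizer ({(UnitaryGroup.finAdelicEquiv (↥(maximalRealSubfield L)) L (IsCMField.complexConj L) 3 H') (UnitaryGroup.finPart (↥(maximalRealSubfield L)) L (IsCMField.complexConj L) 3 H' ((UnitaryGroup.cmDatum L 3 H').toAdelic (Quotient.out c))) v} : Set ↥(UnitaryGroup.localPi L (IsCMField.complexConj L) 3 H' v)))) _ (mem_centralizer_singleton_iff_forall_mem (fun v => UnitaryGroup.localInt L (IsCMField.complexConj L) 3 H' v) ((UnitaryGroup.finAdelicEquiv (↥(maximalRealSubfield L)) L (IsCMField.complexConj L) 3 H') (UnitaryGroup.finPart (↥(maximalRealSubfield L)) L (IsCMField.complexConj L) 3 H' ((UnitaryGroup.cmDatum L 3 H').toAdelic (Quotient.out c)))))) continuous_id continuous_id) ρ ∧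
            tf = Measure.map (subgroupCongrHomeomorph (UnitaryGroup.finAdelicEquiv (↥(maximalRealSubfield L)) L (IsCMField.complexConj L) 3 H').symm.toMulEquiv (Subgroup.centralizer ({(UnitaryGroup.finAdelicEquiv (↥(maximalRealSubfield L)) L (IsCMField.complexConj L) 3 H') (UnitaryGroup.finPart (↥(maximalRealSubfield L)) L (IsCMField.complexConj L) 3 H' ((UnitaryGroup.cmDatum L 3 H').toAdelic (Quotient.out c)))} : Set (Πʳ v : HeightOneSpectrum (𝓞 ↥(maximalRealSubfield L)), [↥(UnitaryGroup.localPi L (IsCMField.complexConj L) 3 H' v), UnitaryGroup.localInt L (IsCMField.complexConj L) 3 H' v]))) (Subgroup.centralizer ({(UnitaryGroup.finPart (↥(maximalRealSubfield L)) L (IsCMField.complexConj L) 3 H' ((UnitaryGroup.cmDatum L 3 H').toAdelic (Quotient.out c)))} : Set (UnitaryGroup.finAdelic (↥(maximalRealSubfield L)) L (IsCMField.complexConj L) 3 H'))) (forall_apply_mem_centralizer_singleton_iff_of_eq (UnitaryGroup.finAdelicEquiv (↥(maximalRealSubfield L)) L (IsCMField.complexConj L) 3 H').symm.toMulEquiv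 ((UnitaryGroup.finAdelicEquiv (↥(maximalRealSubfield L)) L (IsCMField.complexConj L) 3 H').symm_apply_apply (UnitaryGroup.finPart (↥(maximalRealSubfield L)) L (IsCMField.complexConj L) 3 H' ((UnitaryGroup.cmDatum L 3 H').toAdelic (Quotient.out c))))) (UnitaryGroup.finAdelicEquiv (↥(maximalRealSubfield L)) L (IsCMField.complexConj L) 3 H').symm.continuous (UnitaryGroup.finAdelicEquiv (↥(maximalRealSubfield L)) L (IsCMField.complexConj L) 3 H').continuous) ρM ∧
            -- the archimedean factor is the TOP-FORM centraliser measure [§1.7 p. 6 «dg = c|Ω|_v»] and `tA c` is the product carried along `e` (★ O10-s `tP`, `tA` with `ti := centralizerTopFormHaar`)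
            Measure.map (Subgroup.prodEquiv (Subgroup.centralizer ({UnitaryGroup.archPart (↥(maximalRealSubfield L)) L (IsCMField.complexConj L) 3 H' ((UnitaryGroup.cmDatum L 3 H').toAdelic (Quotient.out c))} : Set (UnitaryGroup.arch (↥(maximalRealSubfield L)) L (IsCMField.complexConj L) 3 H'))) (Subgroup.centralizer ({(UnitaryGroup.finPart (↥(maximalRealSubfield L)) L (IsCMField.complexConj L) 3 H' ((UnitaryGroup.cmDatum L 3 H').toAdelic (Quotient.out c)))} : Set (UnitaryGroup.finAdelic (↥(maximalRealSubfield L)) L (IsCMField.complexConj L) 3 H')))) tP = (Literature.NumberTheory.Weil1964.UnitaryArchTopForm.centralizerTopFormHaar L H' (UnitaryGroup.archPart (↥(maximalRealSubfield L)) L (IsCMField.complexConj L) 3 H' ((UnitaryGroup.cmDatum L 3 H').toAdelic (Quotient.out c)))).prod tf ∧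
            tA c = Measure.map (subgroupCongrHomeomorph e ((Subgroup.centralizer ({UnitaryGroup.archPart (↥(maximalRealSubfield L)) L (IsCMField.complexConj L) 3 H' ((UnitaryGroup.cmDatum L 3 H').toAdelic (Quotient.out c))} : Set (UnitaryGroup.arch (↥(maximalRealSubfield L)) L (IsCMField.complexConj L) 3 H'))).prod (Subgroup.centralizer ({(UnitaryGroup.finPart (↥(maximalRealSubfield L)) L (IsCMField.complexConj L) 3 H' ((UnitaryGroup.cmDatum L 3 H').toAdelic (Quotient.out c)))} : Set (UnitaryGroup.finAdelic (↥(maximalRealSubfield L)) L (IsCMField.complexConj L) 3 H')))) (Subgroup.centralizer ({((UnitaryGroup.cmDatum L 3 H').toAdelic (Quotient.out c))} : Set (UnitaryGroup.cmDatum L 3 H').Adelic)) (forall_apply_mem_centralizer_iff e (hg ((UnitaryGroup.cmDatum L 3 H').toAdelic (Quotient.out c)))) he hes) tP) →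
        ∀ c c' : ConjClasses (UnitaryGroup.cmDatum L 3 H').Rational, ¬ IsRegularElt ((Quotient.out c).val : GL (Fin 3) L) →
          (¬ ∃ ζ : L, (((Quotient.out c).val : GL (Fin 3) L) : Matrix (Fin 3) (Fin 3) L) = ζ • (1 : Matrix (Fin 3) (Fin 3) L)) →
          ¬ IsRegularElt ((Quotient.out c').val : GL (Fin 3) L) →
          (¬ ∃ ζ : L, (((Quotient.out c').val : GL (Fin 3) L) : Matrix (Fin 3) (Fin 3) L) = ζ • (1 : Matrix (Fin 3) (Fin 3) L)) →
          StableClass.ofConjClass c = StableClass.ofConjClass c' →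
          quotientMeasure (((UnitaryGroup.cmDatum L 3 H').quotientSubgroup ⊓
                Subgroup.centralizer ({(UnitaryGroup.cmDatum L 3 H').toAdelic (Quotient.out c)} : Set (UnitaryGroup.cmDatum L 3 H').Adelic)).subgroupOf
                (Subgroup.centralizer ({(UnitaryGroup.cmDatum L 3 H').toAdelic (Quotient.out c)} : Set (UnitaryGroup.cmDatum L 3 H').Adelic))) count
                (isClosed_subgroupOf _ _ ((UnitaryGroup.isClosed_cmDatum_quotientSubgroup L 3 H').inter (hCcl _))) (tA c) Set.univ =
            quotientMeasure (((UnitaryGroup.cmDatum L 3 H').quotientSubgroup ⊓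
                Subgroup.centralizer ({(UnitaryGroup.cmDatum L 3 H').toAdelic (Quotient.out c')} : Set (UnitaryGroup.cmDatum L 3 H').Adelic)).subgroupOf
                (Subgroup.centralizer ({(UnitaryGroup.cmDatum L 3 H').toAdelic (Quotient.out c')} : Set (UnitaryGroup.cmDatum L 3 H').Adelic))) count
                (isClosed_subgroupOf _ _ ((UnitaryGroup.isClosed_cmDatum_quotientSubgroup L 3 H').inter (hCcl _))) (tA c') Set.univ) ∧
      -- κ-BLOCK-TF (= ★ (W6′)'s `hTF` binder with `m₂ := TF`; the letter's ED. 2 CUT B text): at a non-central split-singular `γ₀` with partner `γ_H = (e₁•1₂, e₂)`,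
      -- LOCAL κ-letters `c_v`, `c_∞` with (κ-loc) ∧ (κ-arch) ∧ (κ-sign) — ★ `kappaMass_of_singularLetters`' hypotheses `hloc` `harch` `hsign` TOKEN FOR TOKEN
      (∀ (γ₀ : (UnitaryGroup.cmDatum L 3 H').Rational) (e₁ e₂ : L), e₁ ≠ e₂ →
        ((((γ₀ : unitaryGroup (cmConjRingHom L) H').val : GL (Fin 3) L) : Matrix (Fin 3) (Fin 3) L) - e₁ • (1 : Matrix (Fin 3) (Fin 3) L)) * ((((γ₀ : unitaryGroup (cmConjRingHom L) H').val : GL (Fin 3) L) : Matrix (Fin 3) (Fin 3) L) - e₂ • (1 : Matrix (Fin 3) (Fin 3) L)) = 0 →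
        (¬ ∃ ζ : L, (((γ₀ : unitaryGroup (cmConjRingHom L) H').val : GL (Fin 3) L) : Matrix (Fin 3) (Fin 3) L) = ζ • (1 : Matrix (Fin 3) (Fin 3) L)) →
        -- `e₁` is the DOUBLE eigenvalue (ref1 R1-165 O1: the partner `γH = (e₁•1₂, e₂)` below is print's `γ_H` with `A_{G∕H}(γ_H) = 𝒪_st(γ₀)` only then)
        (((γ₀ : unitaryGroup (cmConjRingHom L) H').val : GL (Fin 3) L) : Matrix (Fin 3) (Fin 3) L).charpoly =
          (Polynomial.X - Polynomial.C e₁) ^ 2 * (Polynomial.X - Polynomial.C e₂) →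
        ∀ (γH : (UnitaryGroup.cmDatum L 2 (Matrix.of fun i j : Fin 2 => if i.val + j.val + 1 = 2 then (1 : L) else 0)).Rational ×
            (UnitaryGroup.cmDatum L 1 (Matrix.of fun i j : Fin 1 => if i.val + j.val + 1 = 1 then (1 : L) else 0)).Rational),
          (((γH.1 : unitaryGroup (cmConjRingHom L) (Matrix.of fun i j : Fin 2 => if i.val + j.val + 1 = 2 then (1 : L) else 0)).val : GL (Fin 2) L) : Matrix (Fin 2) (Fin 2) L) =
            e₁ • (1 : Matrix (Fin 2) (Fin 2) L) →
          (((γH.2 : unitaryGroup (cmConjRingHom L) (Matrix.of fun i j : Fin 1 => if i.val + j.val + 1 = 1 then (1 : L) else 0)).val : GL (Fin 1) L) : Matrix (Fin 1) (Fin 1) L) 0 0 = e₂ →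
          ∃ (c : HeightOneSpectrum (𝓞 ↥(maximalRealSubfield L)) → ℂ) (cinf : ℂ), (∀ v, c v ≠ 0) ∧ cinf ≠ 0 ∧
            -- (κ-loc) [Prop. 8.2.1 (a) p. 117; §4.9 p. 54]: the member's UNSIGNED local stable-class sum at `γ₀` (= print's `Φ^κ(γ₀, ·)` of (4.1.2), n239-1) on a `Δ_v`-matching pair is `c_v · f_v^H(γ_H)`, `c_v ≠ 0`
            (∀ (v : HeightOneSpectrum (𝓞 ↥(maximalRealSubfield L)))
                  (fH : (UnitaryGroup.cmDatum L 2 (Matrix.of fun i j : Fin 2 => if i.val + j.val + 1 = 2 then (1 : L) else 0)).Local v × (UnitaryGroup.cmDatum L 1 (Matrix.of fun i j : Fin 1 => if i.val + j.val + 1 = 1 then (1 : L) else 0)).Local v → ℂ) (f : (UnitaryGroup.cmDatum L 3 H').Local v → ℂ),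
                IsLocSmooth f → IsLocSmooth fH → IsLocalDeltaTransfer L H' v (Δ v) (mH v) (mG v) fH f →
                localStableOrbitalIntegral L 3 H' v (mGs v) f ((UnitaryGroup.cmDatum L 3 H').toLocal v ((UnitaryGroup.cmDatum L 3 H').toAdelic γ₀)) =
                  c v * fH ((UnitaryGroup.cmDatum L 2 (Matrix.of fun i j : Fin 2 => if i.val + j.val + 1 = 2 then (1 : L) else 0)).toLocal v ((UnitaryGroup.cmDatum L 2 (Matrix.of fun i j : Fin 2 => if i.val + j.val + 1 = 2 then (1 : L) else 0)).toAdelic γH.1),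
                    (UnitaryGroup.cmDatum L 1 (Matrix.of fun i j : Fin 1 => if i.val + j.val + 1 = 1 then (1 : L) else 0)).toLocal v ((UnitaryGroup.cmDatum L 1 (Matrix.of fun i j : Fin 1 => if i.val + j.val + 1 = 1 then (1 : L) else 0)).toAdelic γH.2))) ∧
            -- (κ-arch) [Prop. 8.2.1 (a), ℂ∕ℝ case pp. 117–118 (indefinite place); L. 14.5.2 (b) proof p. 238 (compact places `v ∈ S₀`); §4.9]: the same on `G′_∞ = ∏_{v∣∞} G′_v` as ONE real group
            -- («the method of 8.2.1», inside ★ :301's honest bracket): the UNSIGNED archimedean stable-class sum at `γ₀` is `c_∞ · a^H(γ_H)`, `c_∞ = ∏_{v∣∞} Δ_{G_v∕H_v}(γ₀)⁻¹ ≠ 0`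
            (∀ (aH : UnitaryGroup.arch (↥(maximalRealSubfield L)) L (IsCMField.complexConj L) 2 (Matrix.of fun i j : Fin 2 => if i.val + j.val + 1 = 2 then (1 : L) else 0) ×
                    UnitaryGroup.arch (↥(maximalRealSubfield L)) L (IsCMField.complexConj L) 1 (Matrix.of fun i j : Fin 1 => if i.val + j.val + 1 = 1 then (1 : L) else 0) → ℂ)
                  (a : UnitaryGroup.arch (↥(maximalRealSubfield L)) L (IsCMField.complexConj L) 3 H' → ℂ),
                ArchSmooth L 3 H' a → ArchSmooth₂ L aH → IsArchDeltaTransfer L H' Tinf mHi m' aH a →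
                archStableOrbitalIntegral L 3 H' (Literature.NumberTheory.Weil1964.UnitaryArchTopForm.archSingularTopFormFamily L H' νGi) a (cmRationalToArch L 3 H' γ₀) =
                  cinf * aH (cmRationalToArch L 2 (Matrix.of fun i j : Fin 2 => if i.val + j.val + 1 = 2 then (1 : L) else 0) γH.1, cmRationalToArch L 1 (Matrix.of fun i j : Fin 1 => if i.val + j.val + 1 = 1 then (1 : L) else 0) γH.2)) ∧
            -- (κ-sign) [Prop. 8.2.1 (b) proof p. 117 «`ΠΔ_{G_v∕H_v}(γ_{0v}) = 1` for `γ₀ ∈ M`» ALONE = the product formula (the line's `hCTM` carries it at the `G`-REGULAR pairs as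
            -- `SatisfiesProductFormula L H' Δ Tinf.Δ`, pinning the canonical datum's global normalisation; at the (G,H)-regular singular `γ₀` it is print's, inside ★ :301's honest bracket);
            -- L. 14.5.2 (b) p. 239]: the product of the κ-constants over any co-unit set is a POSITIVE real (print: `= 1`; the co-unit set itself is P4's business, not the letter's)
            (∀ S_c : Finset (HeightOneSpectrum (𝓞 ↥(maximalRealSubfield L))), (∀ v ∉ S_c, c v = 1) →
                ∃ r : ℝ, 0 < r ∧ cinf * ∏ v ∈ S_c, c v = (r : ℂ)))



/-! ## §2 S1′-fin-TF-COVOL CLOSED over all frames (the registrable constant; projection to a frame = plain application) -/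

/-- **[Rogawski1990 §14.5 L. 14.5.2 (b); Kottwitz1988 Prop. 2] S1′-fin-TF-COVOL CLOSED**: `TamagawaSingularMembersFinTFCovol` at EVERY frame — the binders of ★ `TamagawaSingularMembersFinTFClosed`
VERBATIM minus the unused `νA`-triple; the ONE added binder `hK : ∀ v, νG_v(U(H′)(𝒪_v)) = 1` is the framed constant's FIRST binder, i.e. it is read right after the frame (a `Prop`-valued
`def` cannot carry it as an unreferenced parameter, and binding it here as well would only double the hypothesis).
The constant the closer edition «S1finTF ⟸ COVOL» registers in place of `stub_S1finTF` (LEAD T9-40 (d3); count-neutral re-denomination).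
[cite: Rogawski1990, §14.5 Lemma 14.5.2 (b) pp. 238–239; §1.7 p. 6, p. 11] [cite: Kottwitz1988, Thm. 1, Prop. 2] -/
def TamagawaSingularMembersFinTFCovolClosed : Prop :=
  ∀ (L : Type) [Field L] [NumberField L] [IsCMField L]
  (H' : Matrix (Fin 3) (Fin 3) L) (Tinf : ArchTransferFactor L H')
    -- σ-algebras of the `G′` side (★ (O10-c5) block), of `H_v`, `G_∞`, `H_∞`, and the Haar data — EXACTLY ★ `SingularEllipticTransfer`'s binders
    [∀ g : (UnitaryGroup.cmDatum L 3 H').Adelic, MeasurableSpace ((UnitaryGroup.cmDatum L 3 H').Adelic ⧸ Subgroup.centralizer ({g} : Set (UnitaryGroup.cmDatum L 3 H').Adelic))]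
    [∀ g : (UnitaryGroup.cmDatum L 3 H').Adelic, BorelSpace ((UnitaryGroup.cmDatum L 3 H').Adelic ⧸ Subgroup.centralizer ({g} : Set (UnitaryGroup.cmDatum L 3 H').Adelic))]
    [∀ γ : UnitaryGroup.arch (↥(maximalRealSubfield L)) L (IsCMField.complexConj L) 3 H',
      MeasurableSpace (UnitaryGroup.arch (↥(maximalRealSubfield L)) L (IsCMField.complexConj L) 3 H' ⧸ Subgroup.centralizer ({γ} : Set (UnitaryGroup.arch (↥(maximalRealSubfield L)) L (IsCMField.complexConj L) 3 H')))]
    [∀ γ : UnitaryGroup.arch (↥(maximalRealSubfield L)) L (IsCMField.complexConj L) 3 H',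
      BorelSpace (UnitaryGroup.arch (↥(maximalRealSubfield L)) L (IsCMField.complexConj L) 3 H' ⧸ Subgroup.centralizer ({γ} : Set (UnitaryGroup.arch (↥(maximalRealSubfield L)) L (IsCMField.complexConj L) 3 H')))]
    [∀ (v : HeightOneSpectrum (𝓞 ↥(maximalRealSubfield L))) (γ : (UnitaryGroup.cmDatum L 3 H').Local v),
      MeasurableSpace ((UnitaryGroup.cmDatum L 3 H').Local v ⧸ Subgroup.centralizer ({γ} : Set ((UnitaryGroup.cmDatum L 3 H').Local v)))]
    [∀ (v : HeightOneSpectrum (𝓞 ↥(maximalRealSubfield L))) (γ : (UnitaryGroup.cmDatum L 3 H').Local v),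
      BorelSpace ((UnitaryGroup.cmDatum L 3 H').Local v ⧸ Subgroup.centralizer ({γ} : Set ((UnitaryGroup.cmDatum L 3 H').Local v)))]
    [∀ v : HeightOneSpectrum (𝓞 ↥(maximalRealSubfield L)), MeasurableSpace ((UnitaryGroup.cmDatum L 3 H').Local v)] [∀ v : HeightOneSpectrum (𝓞 ↥(maximalRealSubfield L)), BorelSpace ((UnitaryGroup.cmDatum L 3 H').Local v)]
    [MeasurableSpace (UnitaryGroup.cmDatum L 3 H').Adelic] [BorelSpace (UnitaryGroup.cmDatum L 3 H').Adelic]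
    [MeasurableSpace (UnitaryGroup.arch (↥(maximalRealSubfield L)) L (IsCMField.complexConj L) 3 H')] [BorelSpace (UnitaryGroup.arch (↥(maximalRealSubfield L)) L (IsCMField.complexConj L) 3 H')]
    [∀ γ : (UnitaryGroup.cmDatum L 3 H').Adelic, MeasurableSpace (↥(Subgroup.centralizer ({γ} : Set (UnitaryGroup.cmDatum L 3 H').Adelic)) ⧸
      ((UnitaryGroup.cmDatum L 3 H').quotientSubgroup ⊓ Subgroup.centralizer ({γ} : Set (UnitaryGroup.cmDatum L 3 H').Adelic)).subgroupOf (Subgroup.centralizer ({γ} : Set (UnitaryGroup.cmDatum L 3 H').Adelic)))]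
    [∀ γ : (UnitaryGroup.cmDatum L 3 H').Adelic, BorelSpace (↥(Subgroup.centralizer ({γ} : Set (UnitaryGroup.cmDatum L 3 H').Adelic)) ⧸
      ((UnitaryGroup.cmDatum L 3 H').quotientSubgroup ⊓ Subgroup.centralizer ({γ} : Set (UnitaryGroup.cmDatum L 3 H').Adelic)).subgroupOf (Subgroup.centralizer ({γ} : Set (UnitaryGroup.cmDatum L 3 H').Adelic)))]
    [∀ γ : (UnitaryGroup.cmDatum L 3 H').Adelic, IsClosed ((Subgroup.centralizer ({γ} : Set (UnitaryGroup.cmDatum L 3 H').Adelic) : Subgroup (UnitaryGroup.cmDatum L 3 H').Adelic) : Set (UnitaryGroup.cmDatum L 3 H').Adelic)]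
    [∀ γ : (UnitaryGroup.cmDatum L 3 H').Adelic, (count : Measure ↥(((UnitaryGroup.cmDatum L 3 H').quotientSubgroup ⊓ Subgroup.centralizer ({γ} : Set (UnitaryGroup.cmDatum L 3 H').Adelic)).subgroupOf
      (Subgroup.centralizer ({γ} : Set (UnitaryGroup.cmDatum L 3 H').Adelic)))).IsHaarMeasure]
    [∀ v : HeightOneSpectrum (𝓞 ↥(maximalRealSubfield L)), MeasurableSpace ((UnitaryGroup.cmDatum L 2 (Matrix.of fun i j : Fin 2 => if i.val + j.val + 1 = 2 then (1 : L) else 0)).Local v ×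
        (UnitaryGroup.cmDatum L 1 (Matrix.of fun i j : Fin 1 => if i.val + j.val + 1 = 1 then (1 : L) else 0)).Local v)]
    [∀ v : HeightOneSpectrum (𝓞 ↥(maximalRealSubfield L)), BorelSpace ((UnitaryGroup.cmDatum L 2 (Matrix.of fun i j : Fin 2 => if i.val + j.val + 1 = 2 then (1 : L) else 0)).Local v ×
        (UnitaryGroup.cmDatum L 1 (Matrix.of fun i j : Fin 1 => if i.val + j.val + 1 = 1 then (1 : L) else 0)).Local v)]
    [∀ (v : HeightOneSpectrum (𝓞 ↥(maximalRealSubfield L))) (a : ((UnitaryGroup.cmDatum L 2 (Matrix.of fun i j : Fin 2 => if i.val + j.val + 1 = 2 then (1 : L) else 0)).Local v ×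
        (UnitaryGroup.cmDatum L 1 (Matrix.of fun i j : Fin 1 => if i.val + j.val + 1 = 1 then (1 : L) else 0)).Local v)),
      MeasurableSpace (((UnitaryGroup.cmDatum L 2 (Matrix.of fun i j : Fin 2 => if i.val + j.val + 1 = 2 then (1 : L) else 0)).Local v ×
        (UnitaryGroup.cmDatum L 1 (Matrix.of fun i j : Fin 1 => if i.val + j.val + 1 = 1 then (1 : L) else 0)).Local v) ⧸ Subgroup.centralizer ({a} : Set ((UnitaryGroup.cmDatum L 2 (Matrix.of fun i j : Fin 2 => if i.val + j.val + 1 = 2 then (1 : L) else 0)).Local v ×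
        (UnitaryGroup.cmDatum L 1 (Matrix.of fun i j : Fin 1 => if i.val + j.val + 1 = 1 then (1 : L) else 0)).Local v)))]
    [∀ (v : HeightOneSpectrum (𝓞 ↥(maximalRealSubfield L))) (a : ((UnitaryGroup.cmDatum L 2 (Matrix.of fun i j : Fin 2 => if i.val + j.val + 1 = 2 then (1 : L) else 0)).Local v ×
        (UnitaryGroup.cmDatum L 1 (Matrix.of fun i j : Fin 1 => if i.val + j.val + 1 = 1 then (1 : L) else 0)).Local v)),
      BorelSpace (((UnitaryGroup.cmDatum L 2 (Matrix.of fun i j : Fin 2 => if i.val + j.val + 1 = 2 then (1 : L) else 0)).Local v ×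
        (UnitaryGroup.cmDatum L 1 (Matrix.of fun i j : Fin 1 => if i.val + j.val + 1 = 1 then (1 : L) else 0)).Local v) ⧸ Subgroup.centralizer ({a} : Set ((UnitaryGroup.cmDatum L 2 (Matrix.of fun i j : Fin 2 => if i.val + j.val + 1 = 2 then (1 : L) else 0)).Local v ×
        (UnitaryGroup.cmDatum L 1 (Matrix.of fun i j : Fin 1 => if i.val + j.val + 1 = 1 then (1 : L) else 0)).Local v)))]
    [MeasurableSpace (UnitaryGroup.arch (↥(maximalRealSubfield L)) L (IsCMField.complexConj L) 3 (Matrix.of fun i j : Fin 3 => if i.val + j.val + 1 = 3 then (1 : L) else 0))] [BorelSpace (UnitaryGroup.arch (↥(maximalRealSubfield L)) L (IsCMField.complexConj L) 3 (Matrix.of fun i j : Fin 3 => if i.val + j.val + 1 = 3 then (1 : L) else 0))]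
    [∀ γ : UnitaryGroup.arch (↥(maximalRealSubfield L)) L (IsCMField.complexConj L) 3 (Matrix.of fun i j : Fin 3 => if i.val + j.val + 1 = 3 then (1 : L) else 0),
      MeasurableSpace (UnitaryGroup.arch (↥(maximalRealSubfield L)) L (IsCMField.complexConj L) 3 (Matrix.of fun i j : Fin 3 => if i.val + j.val + 1 = 3 then (1 : L) else 0) ⧸ Subgroup.centralizer ({γ} : Set (UnitaryGroup.arch (↥(maximalRealSubfield L)) L (IsCMField.complexConj L) 3 (Matrix.of fun i j : Fin 3 => if i.val + j.val + 1 = 3 then (1 : L) else 0))))]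
    [∀ γ : UnitaryGroup.arch (↥(maximalRealSubfield L)) L (IsCMField.complexConj L) 3 (Matrix.of fun i j : Fin 3 => if i.val + j.val + 1 = 3 then (1 : L) else 0),
      BorelSpace (UnitaryGroup.arch (↥(maximalRealSubfield L)) L (IsCMField.complexConj L) 3 (Matrix.of fun i j : Fin 3 => if i.val + j.val + 1 = 3 then (1 : L) else 0) ⧸ Subgroup.centralizer ({γ} : Set (UnitaryGroup.arch (↥(maximalRealSubfield L)) L (IsCMField.complexConj L) 3 (Matrix.of fun i j : Fin 3 => if i.val + j.val + 1 = 3 then (1 : L) else 0))))]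
    [MeasurableSpace (UnitaryGroup.arch (↥(maximalRealSubfield L)) L (IsCMField.complexConj L) 2 (Matrix.of fun i j : Fin 2 => if i.val + j.val + 1 = 2 then (1 : L) else 0) ×
          UnitaryGroup.arch (↥(maximalRealSubfield L)) L (IsCMField.complexConj L) 1 (Matrix.of fun i j : Fin 1 => if i.val + j.val + 1 = 1 then (1 : L) else 0))]
    [BorelSpace (UnitaryGroup.arch (↥(maximalRealSubfield L)) L (IsCMField.complexConj L) 2 (Matrix.of fun i j : Fin 2 => if i.val + j.val + 1 = 2 then (1 : L) else 0) ×
          UnitaryGroup.arch (↥(maximalRealSubfield L)) L (IsCMField.complexConj L) 1 (Matrix.of fun i j : Fin 1 => if i.val + j.val + 1 = 1 then (1 : L) else 0))]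
    [∀ a : (UnitaryGroup.arch (↥(maximalRealSubfield L)) L (IsCMField.complexConj L) 2 (Matrix.of fun i j : Fin 2 => if i.val + j.val + 1 = 2 then (1 : L) else 0) ×
          UnitaryGroup.arch (↥(maximalRealSubfield L)) L (IsCMField.complexConj L) 1 (Matrix.of fun i j : Fin 1 => if i.val + j.val + 1 = 1 then (1 : L) else 0)),
      MeasurableSpace ((UnitaryGroup.arch (↥(maximalRealSubfield L)) L (IsCMField.complexConj L) 2 (Matrix.of fun i j : Fin 2 => if i.val + j.val + 1 = 2 then (1 : L) else 0) ×
          UnitaryGroup.arch (↥(maximalRealSubfield L)) L (IsCMField.complexConj L) 1 (Matrix.of fun i j : Fin 1 => if i.val + j.val + 1 = 1 then (1 : L) else 0)) ⧸ Subgroup.centralizer ({a} : Set (UnitaryGroup.arch (↥(maximalRealSubfield L)) L (IsCMField.complexConj L) 2 (Matrix.of fun i j : Fin 2 => if i.val + j.val + 1 = 2 then (1 : L) else 0) ×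
          UnitaryGroup.arch (↥(maximalRealSubfield L)) L (IsCMField.complexConj L) 1 (Matrix.of fun i j : Fin 1 => if i.val + j.val + 1 = 1 then (1 : L) else 0))))]
    [∀ a : (UnitaryGroup.arch (↥(maximalRealSubfield L)) L (IsCMField.complexConj L) 2 (Matrix.of fun i j : Fin 2 => if i.val + j.val + 1 = 2 then (1 : L) else 0) ×
          UnitaryGroup.arch (↥(maximalRealSubfield L)) L (IsCMField.complexConj L) 1 (Matrix.of fun i j : Fin 1 => if i.val + j.val + 1 = 1 then (1 : L) else 0)),
      BorelSpace ((UnitaryGroup.arch (↥(maximalRealSubfield L)) L (IsCMField.complexConj L) 2 (Matrix.of fun i j : Fin 2 => if i.val + j.val + 1 = 2 then (1 : L) else 0) ×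
          UnitaryGroup.arch (↥(maximalRealSubfield L)) L (IsCMField.complexConj L) 1 (Matrix.of fun i j : Fin 1 => if i.val + j.val + 1 = 1 then (1 : L) else 0)) ⧸ Subgroup.centralizer ({a} : Set (UnitaryGroup.arch (↥(maximalRealSubfield L)) L (IsCMField.complexConj L) 2 (Matrix.of fun i j : Fin 2 => if i.val + j.val + 1 = 2 then (1 : L) else 0) ×
          UnitaryGroup.arch (↥(maximalRealSubfield L)) L (IsCMField.complexConj L) 1 (Matrix.of fun i j : Fin 1 => if i.val + j.val + 1 = 1 then (1 : L) else 0))))]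
    (νH : ∀ v : HeightOneSpectrum (𝓞 ↥(maximalRealSubfield L)), Measure ((UnitaryGroup.cmDatum L 2 (Matrix.of fun i j : Fin 2 => if i.val + j.val + 1 = 2 then (1 : L) else 0)).Local v ×
        (UnitaryGroup.cmDatum L 1 (Matrix.of fun i j : Fin 1 => if i.val + j.val + 1 = 1 then (1 : L) else 0)).Local v))
    (νG : ∀ v : HeightOneSpectrum (𝓞 ↥(maximalRealSubfield L)), Measure ((UnitaryGroup.cmDatum L 3 H').Local v))
    [∀ v, IsFiniteMeasureOnCompacts (νH v)] [∀ v, (νH v).IsMulRightInvariant]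
    [∀ v, (νG v).IsHaarMeasure] [∀ v, (νG v).IsMulRightInvariant]  -- MAIN-b's strength (F2): `νG_v` Haar
    (νGi : Measure (UnitaryGroup.arch (↥(maximalRealSubfield L)) L (IsCMField.complexConj L) 3 H')) (νqi : Measure (UnitaryGroup.arch (↥(maximalRealSubfield L)) L (IsCMField.complexConj L) 3 (Matrix.of fun i j : Fin 3 => if i.val + j.val + 1 = 3 then (1 : L) else 0)))
    (νHi : Measure (UnitaryGroup.arch (↥(maximalRealSubfield L)) L (IsCMField.complexConj L) 2 (Matrix.of fun i j : Fin 2 => if i.val + j.val + 1 = 2 then (1 : L) else 0) ×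
          UnitaryGroup.arch (↥(maximalRealSubfield L)) L (IsCMField.complexConj L) 1 (Matrix.of fun i j : Fin 1 => if i.val + j.val + 1 = 1 then (1 : L) else 0)))
    [IsFiniteMeasureOnCompacts νGi] [νGi.IsMulRightInvariant] [IsFiniteMeasureOnCompacts νqi] [νqi.IsMulRightInvariant]
    [IsFiniteMeasureOnCompacts νHi] [νHi.IsMulRightInvariant],
    TamagawaSingularMembersFinTFCovol L H' Tinf νH νG νGi νqi νHi

end Frame

end Literature.NumberTheory.Rogawski1990

end
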